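import Summits.QuantumFields.YangMills.Theorems.FlatTubeReductionRateScheduleR
import Summits.QuantumFields.YangMills.Theorems.FlatTubeReductionRateBudget
import HarnessLib

/-!
# SCHEDULE «R», part 2: the DEFECT MARGINS of the dressed fixed-`β` estimate, eventually — `hLa`, `hm₁`, `hm₂`, `hP`, `hP0`, `hJ` with fibre radius `R = β^{-1/2}ℓ`, threshold
# `α = β^{-1/2}ℓ²/(2L²)`, gauge core `R₁ = 5β^{-1/2}ℓ²`, rough threshold `P₀ = 13δ` — in QUANTITATIVE form (`m_nt ≥ (3/2)xℓ²` in both branches, far branches `≥ 6δ`, `≥ |Site|α/4`),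
# and the defect-mass floors `βm_nt ≥ (9/4)log⁴β`, `βm_far ≥ log⁴β/(192L)`
# (route `FlatTubeReduction`, crux K1 `NearFlatRatioLaw` stmt-QuantumFields-24720; seat `ym-line-ftr-p1` g16; R2b1 RECORD rung — no summit statement is proved here)

WHY (memo `Cruxes/NearFlatRatioLaw/Lines/ratepack-v5-nearpair-g16.md` §2).  These are the `α`/`R`-dependent elementary hypotheses of `…DressedFixedBetaNear.dressed_fixed_beta_estimate_near`
at schedule R and the two floors the tail budget (next file) consumes.  §1 pure real-arithmetic atoms (one per margin); §2 the raw smallness facts of the schedule; §3 ★ `eventually_marginsR`;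
§4 ★ `eventually_btMnt_ge_R`, ★ `eventually_btMfar_ge_R`.
HONEST FRAMING: real-analysis bookkeeping for a stub of the CONDITIONAL reduction route R2b1; femto rung R2b1 (RECORD label); not infinite volume, not a gap, not Clay.  No defs, no named
facts, no `sorry`.
-/

set_option autoImplicit false

noncomputable section

open MeasureTheory Filter Topology Real
open scoped BigOperators
open Literature.MathematicalPhysics.QuantumFieldTheory
open Literature.MathematicalPhysics.QuantumLattice

namespace Summit.QuantumFields.YangMills.Theorems.FemtoTransferGap.TwoLattice.ConstTube

open Summit.QuantumFields.YangMills.Theorems.FemtoTransferGap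
open Summit.QuantumFields.YangMills.Theorems.FemtoTransferGap.TwoLattice
open Summit.QuantumFields.YangMills.Theorems.FemtoTransferGap.TwoLattice.Avg
open Summit.QuantumFields.YangMills.Theorems.FemtoTransferGap.TwoLattice.Cov

variable {L : ℕ} [NeZero L]

/-! ## §1 Real-arithmetic atoms -/

omit [NeZero L] in
/-- Near branch 1: `(3/2)xℓ² ≤ R₁/2 − 2(√2R+δ)ε − (2√2R + α)` for `R₁ = 5xℓ²`, `R = ℓx`, `ℓ ≥ 8`, `0 ≤ ε ≤ x ≤ 1`, `√2R + δ ≤ 1`, `0 ≤ δ`, `α ≤ xℓ²/2`. [folklore] -/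
theorem marginR_near1 {x ℓ δ ε α : ℝ} (hx0 : 0 ≤ x) (hℓ : 8 ≤ ℓ) (hδ0 : 0 ≤ δ) (hε0 : 0 ≤ ε) (hεx : ε ≤ x) (hsd : Real.sqrt 2 * (ℓ * x) + δ ≤ 1)
    (hα : α ≤ x * ℓ ^ 2 / 2) :
    3 / 2 * (x * ℓ ^ 2) ≤ 5 * (x * ℓ ^ 2) / 2 - 2 * (Real.sqrt 2 * (ℓ * x) + δ) * ε - (2 * Real.sqrt 2 * (ℓ * x) + α) := by
  have hs20 : 0 ≤ Real.sqrt 2 := Real.sqrt_nonneg _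
  have hxl0 : 0 ≤ ℓ * x := mul_nonneg (by linarith) hx0
  have a1 : 2 * (Real.sqrt 2 * (ℓ * x) + δ) * ε ≤ 2 * x := by
    have h0 : 0 ≤ Real.sqrt 2 * (ℓ * x) + δ := by positivity
    have := mul_le_mul hsd hεx hε0 zero_le_one
    linarith
  have a2 : 2 * Real.sqrt 2 * (ℓ * x) ≤ 3 * (ℓ * x) := by nlinarith [(by rw [Real.sqrt_le_left (by norm_num)]; norm_num : Real.sqrt 2 ≤ 3 / 2)]
  have a3 : 2 * x + 3 * (ℓ * x) ≤ x * ℓ ^ 2 / 2 := by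
    have h1 : 4 + 6 * ℓ ≤ ℓ ^ 2 := by nlinarith
    have h2 := mul_le_mul_of_nonneg_left h1 hx0
    nlinarith [h2]
  linarith

omit [NeZero L] in
/-- Near branch 2: `(3/2)xℓ² ≤ 1/(3L) − 4(√2R+δ) − (2√2R+α)` once `6√2R + 4δ + xℓ² ≤ 1/(6L)`, `(3/2)xℓ² ≤ 1/(6L)`, `α ≤ xℓ²/2`, `0 ≤ xℓ²`. [folklore] -/
theorem marginR_near2 {x ℓ δ α c : ℝ} (h1 : 6 * Real.sqrt 2 * (ℓ * x) + 4 * δ + x * ℓ ^ 2 ≤ c) (h2 : 3 / 2 * (x * ℓ ^ 2) ≤ c) (hα : α ≤ x * ℓ ^ 2 / 2) (hxl : 0 ≤ x * ℓ ^ 2) :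
    3 / 2 * (x * ℓ ^ 2) ≤ (c + c) - 4 * (Real.sqrt 2 * (ℓ * x) + δ) - (2 * Real.sqrt 2 * (ℓ * x) + α) := by
  linarith

omit [NeZero L] in
/-- Rough branch: `6δ ≤ P₀ − 4(√2R+δ) − (2√2R + 2δ)` for `P₀ = 13δ` once `ℓx ≤ δ/9`. [folklore] -/
theorem marginR_rough {x ℓ δ : ℝ} (hxl0 : 0 ≤ ℓ * x) (hxl : ℓ * x ≤ δ / 9) :
    6 * δ ≤ 13 * δ - 4 * (Real.sqrt 2 * (ℓ * x) + δ) - (2 * Real.sqrt 2 * (ℓ * x) + 2 * δ) := by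
  have : 6 * Real.sqrt 2 * (ℓ * x) ≤ 9 * (ℓ * x) := by nlinarith [(by rw [Real.sqrt_le_left (by norm_num)]; norm_num : Real.sqrt 2 ≤ 3 / 2)]
  linarith

omit [NeZero L] in
/-- Signal branch: `Nα/4 ≤ N(1 − 3L'P)α − (2εNδ + 2R² + 2√2N(9L'P + ε)R)` for `α = a ≥ 0`, `R = ℓx`, once `3L'P ≤ 1/4` and each junk term is `≤ Na/6`. [folklore] -/
theorem marginR_signal {N a j₁ j₂ j₃ q : ℝ} (hN : 0 ≤ N) (ha : 0 ≤ a) (hq : q ≤ 1 / 4) (h1 : j₁ ≤ N * a / 6) (h2 : j₂ ≤ N * a / 6) (h3 : j₃ ≤ N * a / 6) :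
    N * a / 4 ≤ N * (1 - q) * a - (j₁ + j₂ + j₃) := by
  have : N * (3 / 4) * a ≤ N * (1 - q) * a := mul_le_mul_of_nonneg_right (mul_le_mul_of_nonneg_left (by linarith) hN) ha
  nlinarith

omit [NeZero L] in
/-- Junk term 1: `2εNδ ≤ Na/6` with `a = xℓ²/(2L²)`, given `ε ≤ x²`, `δ ≤ 1`, `24L²x ≤ 1`, `ℓ ≥ 1`. [folklore] -/
theorem junkR_one {N x ℓ δ ε Lr : ℝ} (hN : 0 ≤ N) (hx0 : 0 ≤ x) (hℓ : 1 ≤ ℓ) (hδ0 : 0 ≤ δ) (hδ1 : δ ≤ 1) (hε : ε ≤ x ^ 2) (hLr : 0 < Lr)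
    (hx24 : 24 * Lr ^ 2 * x ≤ 1) :
    2 * ε * N * δ ≤ N * (x * ℓ ^ 2 / (2 * Lr ^ 2)) / 6 := by
  have hL2 : 0 < 2 * Lr ^ 2 := by positivity
  rw [le_div_iff₀ (by norm_num : (0 : ℝ) < 6), mul_div_assoc', le_div_iff₀ hL2]
  have hl2 : 1 ≤ ℓ ^ 2 := one_le_pow₀ hℓ
  have d : 2 * ε * N * δ * 6 * (2 * Lr ^ 2) = N * ((24 * Lr ^ 2 * x) * (x * δ)) + N * (24 * Lr ^ 2) * ((ε - x ^ 2) * δ) := by ring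
  rw [d]
  have a : (24 * Lr ^ 2 * x) * (x * δ) ≤ 1 * (x * δ) := mul_le_mul_of_nonneg_right hx24 (by positivity)
  have b : x * δ ≤ x * ℓ ^ 2 := by nlinarith [mul_le_mul_of_nonneg_left hδ1 hx0, mul_le_mul_of_nonneg_left hl2 hx0]
  have c : (ε - x ^ 2) * δ ≤ 0 := mul_nonpos_of_nonpos_of_nonneg (by linarith) hδ0
  have e1 : N * ((24 * Lr ^ 2 * x) * (x * δ)) ≤ N * (x * ℓ ^ 2) := mul_le_mul_of_nonneg_left (by linarith) hN
  have e2 : N * (24 * Lr ^ 2) * ((ε - x ^ 2) * δ) ≤ 0 := mul_nonpos_of_nonneg_of_nonpos (by positivity) c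
  linarith

/-- Junk term 2: `2R² ≤ Na/6` (`R = ℓx`), given `24L²x ≤ 1 ≤ N`. [folklore] -/
theorem junkR_two {N x ℓ Lr : ℝ} (hN1 : 1 ≤ N) (hx0 : 0 ≤ x) (hLr : 0 < Lr) (hx24 : 24 * Lr ^ 2 * x ≤ 1) :
    2 * (ℓ * x) ^ 2 ≤ N * (x * ℓ ^ 2 / (2 * Lr ^ 2)) / 6 := by
  have hL2 : 0 < 2 * Lr ^ 2 := by positivity
  rw [le_div_iff₀ (by norm_num : (0 : ℝ) < 6), mul_div_assoc', le_div_iff₀ hL2]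
  have e : 2 * (ℓ * x) ^ 2 * 6 * (2 * Lr ^ 2) = (x * ℓ ^ 2) * (24 * Lr ^ 2 * x) := by ring
  rw [e]
  have hxl : 0 ≤ x * ℓ ^ 2 := by positivity
  calc (x * ℓ ^ 2) * (24 * Lr ^ 2 * x) ≤ (x * ℓ ^ 2) * 1 := mul_le_mul_of_nonneg_left hx24 hxl
    _ ≤ N * (x * ℓ ^ 2) := by rw [mul_one]; exact le_mul_of_one_le_left hxl hN1

omit [NeZero L] in
/-- Junk term 3: `2√2N(9L'P + ε)R ≤ Na/6` given `ε ≤ x²`, `36L²(9L'P + x²) ≤ 1/2`, `ℓ ≥ 1`. [folklore] -/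
theorem junkR_three {N x ℓ ε P9 Lr : ℝ} (hN : 0 ≤ N) (hx0 : 0 ≤ x) (hℓ : 1 ≤ ℓ) (hε0 : 0 ≤ ε) (hε : ε ≤ x ^ 2) (hP9 : 0 ≤ P9) (hLr : 0 < Lr)
    (h36 : 36 * Lr ^ 2 * (P9 + x ^ 2) ≤ 1 / 2) :
    2 * Real.sqrt 2 * N * (P9 + ε) * (ℓ * x) ≤ N * (x * ℓ ^ 2 / (2 * Lr ^ 2)) / 6 := by
  have hL2 : 0 < 2 * Lr ^ 2 := by positivity
  have hs : Real.sqrt 2 ≤ 3 / 2 := by rw [Real.sqrt_le_left (by norm_num)]; norm_num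
  have hs0 : 0 ≤ Real.sqrt 2 := Real.sqrt_nonneg _
  have hℓ0 : 0 ≤ ℓ := by linarith
  have hxl : 0 ≤ ℓ * x := by positivity
  have a : 2 * Real.sqrt 2 * N * (P9 + ε) * (ℓ * x) ≤ 3 * N * (P9 + x ^ 2) * (ℓ * x) := by
    have h1 : 2 * Real.sqrt 2 ≤ 3 := by linarith
    have h2 : P9 + ε ≤ P9 + x ^ 2 := by linarith
    have h3 : 0 ≤ P9 + ε := by positivity
    have := mul_le_mul h1 h2 h3 (by norm_num)
    have hNxl : 0 ≤ N * (ℓ * x) := by positivity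
    nlinarith [this, hNxl]
  refine a.trans ?_
  rw [le_div_iff₀ (by norm_num : (0 : ℝ) < 6), mul_div_assoc', le_div_iff₀ hL2]
  have e : 3 * N * (P9 + x ^ 2) * (ℓ * x) * 6 * (2 * Lr ^ 2) = N * (ℓ * x) * (36 * Lr ^ 2 * (P9 + x ^ 2)) := by ring
  rw [e]
  have f : N * (ℓ * x) * (36 * Lr ^ 2 * (P9 + x ^ 2)) ≤ N * (ℓ * x) * (1 / 2) := mul_le_mul_of_nonneg_left h36 (by positivity)
  have g : ℓ * x ≤ x * ℓ ^ 2 := by nlinarith [mul_le_mul_of_nonneg_left hℓ hxl]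
  nlinarith [f, g, mul_le_mul_of_nonneg_left g hN]

/-! ## §2 Raw smallness facts at schedule R -/

/-- `ℓx = δ·(|Site|/(14D))·(β^{-1/3}ℓ)` at the rate window (`β ≥ 1`). [folklore] -/
theorem btLog_mul_powScale_half_eq_delta_mul {D β : ℝ} (hD : 0 < D) (hβ1 : 1 ≤ β) :
    btLog β * powScale (1 / 2) β = (D * recordDelta1 L (1 / 6) β) * (((Fintype.card (Site 3 L) : ℝ) / (14 * D)) * (powScale (1 / 3) β * btLog β)) := by
  have hβ0 : 0 < β := by linarith
  have hN : (0 : ℝ) < (Fintype.card (Site 3 L) : ℝ) := by exact_mod_cast Fintype.card_pos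
  have e : powScale (1 / 2) β = powScale (1 / 6) β * powScale (1 / 3) β := by
    rw [powScale_eq hβ1, powScale_eq hβ1, powScale_eq hβ1, ← Real.rpow_add hβ0]; norm_num
  unfold recordDelta1
  rw [e]; field_simp

/-- `btEps ≤ x²` (`btEps = β⁻¹ = x²` for `β ≥ 1`). [folklore] -/
theorem btEps_le_powScale_half_sq {β : ℝ} (hβ1 : 1 ≤ β) : btEps β ≤ powScale (1 / 2) β ^ 2 := by
  have hβ0 : 0 ≤ β := by linarith
  have e : powScale (1 / 2) β ^ 2 = powScale 1 β := by
    rw [powScale_eq hβ1, powScale_eq hβ1, ← Real.rpow_mul_natCast hβ0]; norm_num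
  rw [e]; exact le_rfl

/-- ★ Raw smallness facts at schedule R, eventually: `ℓ ≥ 8`, `24L²x ≤ 1`, `ℓx ≤ δ/9`, `6√2ℓx + 4δ + xℓ² ≤ 1/(6L)`, `(3/2)xℓ² ≤ 1/(6L)`, `√2ℓx + δ ≤ 1`, `18L(√2ℓx + δ) ≤ 1/2`,
`39Lδ ≤ 1/4`, `36L²(117Lδ + x²) ≤ 1/2`. [folklore] -/
theorem eventually_scheduleR_small {D : ℝ} (hD : 1 ≤ D) :
    ∀ᶠ β : ℝ in atTop, 8 ≤ btLog β ∧ 24 * (L : ℝ) ^ 2 * powScale (1 / 2) β ≤ 1 ∧ btLog β * powScale (1 / 2) β ≤ D * recordDelta1 L (1 / 6) β / 9 ∧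
      6 * Real.sqrt 2 * (btLog β * powScale (1 / 2) β) + 4 * (D * recordDelta1 L (1 / 6) β) + powScale (1 / 2) β * btLog β ^ 2 ≤ 1 / (6 * L) ∧
      3 / 2 * (powScale (1 / 2) β * btLog β ^ 2) ≤ 1 / (6 * L) ∧ Real.sqrt 2 * (btLog β * powScale (1 / 2) β) + D * recordDelta1 L (1 / 6) β ≤ 1 ∧
      18 * L * (Real.sqrt 2 * (btLog β * powScale (1 / 2) β) + D * recordDelta1 L (1 / 6) β) ≤ 1 / 2 ∧
      3 * L * (13 * (D * recordDelta1 L (1 / 6) β)) ≤ 1 / 4 ∧ 36 * (L : ℝ) ^ 2 * (9 * L * (13 * (D * recordDelta1 L (1 / 6) β)) + powScale (1 / 2) β ^ 2) ≤ 1 / 2 := by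
  have hL1 : (1 : ℝ) ≤ L := by exact_mod_cast NeZero.one_le
  have hL0 : (0 : ℝ) < L := by linarith
  have hD0 : 0 < D := by linarith
  have hN : (0 : ℝ) < (Fintype.card (Site 3 L) : ℝ) := by exact_mod_cast Fintype.card_pos
  have hs : Real.sqrt 2 ≤ 3 / 2 := by rw [Real.sqrt_le_left (by norm_num)]; norm_num
  have hs0 : 0 ≤ Real.sqrt 2 := Real.sqrt_nonneg _
  have hδt : Tendsto (fun β : ℝ => D * recordDelta1 L (1 / 6) β) atTop (𝓝 0) := by
    simpa using (tendsto_recordDelta1 (L := L) (show (0 : ℝ) < 1 / 6 by norm_num)).const_mul D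
  have txl : Tendsto (fun β : ℝ => btLog β * powScale (1 / 2) β) atTop (𝓝 0) := by
    refine (tendsto_powScale_mul_btLog_pow (show (0 : ℝ) < 1 / 2 by norm_num) 1).congr' (Eventually.of_forall fun β => by ring)
  have txl2 := tendsto_powScale_mul_btLog_pow (show (0 : ℝ) < 1 / 2 by norm_num) 2
  have tx := tendsto_powScale (show (0 : ℝ) < 1 / 2 by norm_num)
  have t3 := tendsto_powScale_mul_btLog_pow (show (0 : ℝ) < 1 / 3 by norm_num) 1
  have hc : (0 : ℝ) < 1 / (6 * L) / 30 := by positivity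
  have hc' : (0 : ℝ) < 1 / (36 * (L : ℝ) ^ 2) / 4 := by positivity
  filter_upwards [eventually_ge_atTop (1 : ℝ), Real.tendsto_log_atTop.eventually_ge_atTop (8 : ℝ), eventually_btLog_eq,
    tx.eventually (eventually_le_nhds (show (0 : ℝ) < 1 / (24 * (L : ℝ) ^ 2) by positivity)),
    t3.eventually (eventually_le_nhds (show (0 : ℝ) < 14 * D / (Fintype.card (Site 3 L) : ℝ) / 9 by positivity)),
    txl.eventually (eventually_le_nhds hc), hδt.eventually (eventually_le_nhds hc), txl2.eventually (eventually_le_nhds hc),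
    hδt.eventually (eventually_le_nhds (show (0 : ℝ) < 1 / (36 * (L : ℝ) ^ 2) / 4 / (117 * L) by positivity)),
    tx.eventually (eventually_le_nhds (show (0 : ℝ) < 1 / (36 * (L : ℝ) ^ 2) / 4 by positivity))] with β hβ1 hℓ8 hℓeq hx24 h3 hxl hδ hxl2 hδ' hx'
  rw [pow_one] at h3
  have hx0 : 0 < powScale (1 / 2) β := powScale_pos _ _
  have hx1 : powScale (1 / 2) β ≤ 1 := powScale_le_one (by norm_num) β
  have hℓ0 : 0 ≤ btLog β := le_trans zero_le_one (one_le_btLog β)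
  have hδ0 : 0 ≤ D * recordDelta1 L (1 / 6) β := scaledDelta1_nonneg (by linarith) β
  have hxl0 : 0 ≤ btLog β * powScale (1 / 2) β := by positivity
  have hL6 : 1 / (6 * (L : ℝ)) / 30 ≤ 1 / 180 := by
    rw [div_div]; rw [div_le_div_iff_of_pos_left one_pos (by positivity) (by norm_num)]; nlinarith
  refine ⟨by rw [hℓeq]; exact hℓ8, ?_, ?_, ?_, by linarith, ?_, ?_, ?_, ?_⟩
  · have := mul_le_mul_of_nonneg_left hx24 (by positivity : (0 : ℝ) ≤ 24 * (L : ℝ) ^ 2)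
    rwa [mul_one_div_cancel (by positivity : (24 : ℝ) * (L : ℝ) ^ 2 ≠ 0)] at this
  · -- `ℓx ≤ δ/9`
    rw [btLog_mul_powScale_half_eq_delta_mul (L := L) hD0 hβ1, le_div_iff₀ (by norm_num : (0 : ℝ) < 9)]
    have hq : (Fintype.card (Site 3 L) : ℝ) / (14 * D) * (powScale (1 / 3) β * btLog β) ≤ 1 / 9 := by
      have := mul_le_mul_of_nonneg_left h3 (show (0 : ℝ) ≤ (Fintype.card (Site 3 L) : ℝ) / (14 * D) by positivity)
      refine this.trans (le_of_eq ?_)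
      field_simp
    have := mul_le_mul_of_nonneg_left hq hδ0
    linarith
  · -- `6√2ℓx + 4δ + xℓ² ≤ 1/(6L)`
    have a1 : 6 * Real.sqrt 2 * (btLog β * powScale (1 / 2) β) ≤ 9 * (btLog β * powScale (1 / 2) β) := by nlinarith
    linarith
  · -- `√2ℓx + δ ≤ 1`
    have : Real.sqrt 2 * (btLog β * powScale (1 / 2) β) ≤ 3 / 2 * (btLog β * powScale (1 / 2) β) := mul_le_mul_of_nonneg_right hs hxl0
    linarith
  · -- `hLa`
    have h1 : Real.sqrt 2 * (btLog β * powScale (1 / 2) β) + D * recordDelta1 L (1 / 6) β ≤ 3 / 2 * (1 / (6 * L) / 30) + 1 / (6 * L) / 30 := by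
      have : Real.sqrt 2 * (btLog β * powScale (1 / 2) β) ≤ 3 / 2 * (btLog β * powScale (1 / 2) β) := mul_le_mul_of_nonneg_right hs hxl0
      linarith
    have h2 := mul_le_mul_of_nonneg_left h1 (by positivity : (0 : ℝ) ≤ 18 * L)
    have e : 18 * (L : ℝ) * (3 / 2 * (1 / (6 * L) / 30) + 1 / (6 * L) / 30) = 1 / 4 := by field_simp; ring
    linarith
  · -- `39Lδ ≤ 1/4`
    have : 3 * (L : ℝ) * (13 * (D * recordDelta1 L (1 / 6) β)) ≤ 3 * L * (13 * (1 / (6 * L) / 30)) := by gcongr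
    have e : 3 * (L : ℝ) * (13 * (1 / (6 * L) / 30)) = 13 / 60 := by field_simp; ring
    linarith
  · -- `36L²(117Lδ + x²) ≤ 1/2`
    have hx2 : powScale (1 / 2) β ^ 2 ≤ powScale (1 / 2) β := by nlinarith
    have a1 : 9 * (L : ℝ) * (13 * (D * recordDelta1 L (1 / 6) β)) ≤ 1 / (36 * (L : ℝ) ^ 2) / 4 := by
      have := mul_le_mul_of_nonneg_left hδ' (by positivity : (0 : ℝ) ≤ 117 * L)
      have e : 117 * (L : ℝ) * (1 / (36 * (L : ℝ) ^ 2) / 4 / (117 * L)) = 1 / (36 * (L : ℝ) ^ 2) / 4 := by field_simp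
      linarith
    have a2 : powScale (1 / 2) β ^ 2 ≤ 1 / (36 * (L : ℝ) ^ 2) / 4 := hx2.trans hx'
    have h := mul_le_mul_of_nonneg_left (add_le_add a1 a2) (by positivity : (0 : ℝ) ≤ 36 * (L : ℝ) ^ 2)
    have e : 36 * (L : ℝ) ^ 2 * (1 / (36 * (L : ℝ) ^ 2) / 4 + 1 / (36 * (L : ℝ) ^ 2) / 4) = 1 / 2 := by field_simp; ring
    linarith

/-! ## §3 ★ The margins at schedule R -/

/-- ★ **The six margin hypotheses of `dressed_fixed_beta_estimate_near` at schedule R, eventually, in quantitative form** (`x = powScale(1/2)`, `ℓ = btLog`, `R = ℓx`,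
`δ = D·recordDelta1 L (1/6)`, `ε = btEps`, `α = xℓ²/(2L²)`, `R₁ = 5xℓ²`, `P₀ = 13δ`). [folklore] -/
theorem eventually_marginsR {D : ℝ} (hD : 1 ≤ D) :
    ∀ᶠ β : ℝ in atTop,
      18 * L * (Real.sqrt 2 * (btLog β * powScale (1 / 2) β) + D * recordDelta1 L (1 / 6) β) ≤ 1 / 2 ∧
      3 / 2 * (powScale (1 / 2) β * btLog β ^ 2) ≤ 5 * (powScale (1 / 2) β * btLog β ^ 2) / 2 -
          2 * (Real.sqrt 2 * (btLog β * powScale (1 / 2) β) + D * recordDelta1 L (1 / 6) β) * btEps β -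
          (2 * Real.sqrt 2 * (btLog β * powScale (1 / 2) β) + powScale (1 / 2) β * btLog β ^ 2 / (2 * (L : ℝ) ^ 2)) ∧
      3 / 2 * (powScale (1 / 2) β * btLog β ^ 2) ≤ 1 / (3 * L) - 4 * (Real.sqrt 2 * (btLog β * powScale (1 / 2) β) + D * recordDelta1 L (1 / 6) β) -
          (2 * Real.sqrt 2 * (btLog β * powScale (1 / 2) β) + powScale (1 / 2) β * btLog β ^ 2 / (2 * (L : ℝ) ^ 2)) ∧
      3 * L * (13 * (D * recordDelta1 L (1 / 6) β)) < 1 ∧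
      6 * (D * recordDelta1 L (1 / 6) β) ≤ 13 * (D * recordDelta1 L (1 / 6) β) - 4 * (Real.sqrt 2 * (btLog β * powScale (1 / 2) β) + D * recordDelta1 L (1 / 6) β) -
          (2 * Real.sqrt 2 * (btLog β * powScale (1 / 2) β) + 2 * (D * recordDelta1 L (1 / 6) β)) ∧
      Fintype.card (Site 3 L) * (powScale (1 / 2) β * btLog β ^ 2 / (2 * (L : ℝ) ^ 2)) / 4 ≤
        Fintype.card (Site 3 L) * (1 - 3 * L * (13 * (D * recordDelta1 L (1 / 6) β))) * (powScale (1 / 2) β * btLog β ^ 2 / (2 * (L : ℝ) ^ 2)) -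
          (2 * btEps β * Fintype.card (Site 3 L) * (D * recordDelta1 L (1 / 6) β) + 2 * (btLog β * powScale (1 / 2) β) ^ 2 +
            2 * Real.sqrt 2 * Fintype.card (Site 3 L) * (9 * L * (13 * (D * recordDelta1 L (1 / 6) β)) + btEps β) * (btLog β * powScale (1 / 2) β)) := by
  have hL1 : (1 : ℝ) ≤ L := by exact_mod_cast NeZero.one_le
  have hL0 : (0 : ℝ) < L := by linarith
  have hN1 : (1 : ℝ) ≤ Fintype.card (Site 3 L) := by exact_mod_cast Fintype.card_pos
  have hN : (0 : ℝ) ≤ Fintype.card (Site 3 L) := by linarith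
  filter_upwards [eventually_scheduleR_facts (L := L) hD, eventually_scheduleR_small (L := L) hD] with β hf hs
  obtain ⟨hβ1, -, hℓ1, hδ0, -, hδhalf, hx0, hx1, -, -, -, -, -, -, -, -, -, -, -, -, hα0, -, -, -, -, hεx⟩ := hf
  obtain ⟨hℓ8, hx24, hxlδ, h6L, h32, hsd, hLa, h39, h36⟩ := hs
  have hℓ0 : 0 ≤ btLog β := by linarith
  have hxl0 : 0 ≤ btLog β * powScale (1 / 2) β := by positivity
  have hxl20 : 0 ≤ powScale (1 / 2) β * btLog β ^ 2 := by positivity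
  have hε0 : 0 ≤ btEps β := (powScale_pos _ _).le
  have hδ1 : D * recordDelta1 L (1 / 6) β ≤ 1 := by linarith
  have hL2 : (2 : ℝ) ≤ 2 * (L : ℝ) ^ 2 := by nlinarith [one_le_pow₀ (M₀ := ℝ) hL1 (n := 2)]
  have hαhalf : powScale (1 / 2) β * btLog β ^ 2 / (2 * (L : ℝ) ^ 2) ≤ powScale (1 / 2) β * btLog β ^ 2 / 2 := div_le_div_of_nonneg_left hxl20 two_pos hL2
  refine ⟨hLa, marginR_near1 hx0.le hℓ8 hδ0 hε0 hεx hsd hαhalf, ?_, by linarith, marginR_rough hxl0 hxlδ, ?_⟩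
  · have e3 : (1 : ℝ) / (3 * L) = 1 / (6 * L) + 1 / (6 * L) := by field_simp; norm_num
    rw [e3]; exact marginR_near2 h6L h32 hαhalf hxl20
  · exact marginR_signal hN hα0 h39 (junkR_one hN hx0.le hℓ1 hδ0 hδ1 (btEps_le_powScale_half_sq hβ1) hL0 hx24) (junkR_two hN1 hx0.le hL0 hx24)
      (junkR_three hN hx0.le hℓ1 hε0 (btEps_le_powScale_half_sq hβ1) (by positivity) hL0 h36)

/-! ## §4 ★ The defect-mass floors at schedule R -/

/-- ★ **`(9/4)·log⁴β ≤ β·m_nt` eventually at schedule R** (both branches of `m_nt` are `≥ (3/2)xℓ²`, `β(xℓ²)² = ℓ⁴`). [folklore] -/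
theorem eventually_btMnt_ge_R {D : ℝ} (hD : 1 ≤ D) :
    ∀ᶠ β : ℝ in atTop, 9 / 4 * Real.log β ^ 4 ≤
      β * btMnt L (D * recordDelta1 L (1 / 6) β) (powScale (1 / 2) β * btLog β ^ 2 / (2 * (L : ℝ) ^ 2)) (btLog β * powScale (1 / 2) β)
        (5 * (powScale (1 / 2) β * btLog β ^ 2)) (btEps β) := by
  filter_upwards [eventually_marginsR (L := L) hD, eventually_scheduleR_facts (L := L) hD] with β hm hf
  obtain ⟨-, hm₁, hm₂, -⟩ := hm
  obtain ⟨hβ1, hℓeq, -, -, -, -, hx0, -, hβx, -⟩ := hf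
  have hxl20 : 0 ≤ 3 / 2 * (powScale (1 / 2) β * btLog β ^ 2) := by have := one_le_btLog β; positivity
  have hkey := btMnt_ge_sq (L := L) hxl20 hm₁ hm₂
  have e : β * (3 / 2 * (powScale (1 / 2) β * btLog β ^ 2)) ^ 2 = 9 / 4 * btLog β ^ 4 * (β * powScale (1 / 2) β ^ 2) := by ring
  calc 9 / 4 * Real.log β ^ 4 = β * (3 / 2 * (powScale (1 / 2) β * btLog β ^ 2)) ^ 2 := by rw [e, hβx, mul_one, hℓeq]
    _ ≤ _ := mul_le_mul_of_nonneg_left hkey (by linarith)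

/-- ★ **`log⁴β/(192L) ≤ β·m_far` eventually at schedule R** (rough branch `≥ (6δ)²` with `36βδ² ≫ log⁴β`, signal branch `≥ (|Site|α/4)²/|E| = ℓ⁴/(192L)`). [folklore] -/
theorem eventually_btMfar_ge_R {D : ℝ} (hD : 1 ≤ D) :
    ∀ᶠ β : ℝ in atTop, Real.log β ^ 4 / (192 * L) ≤
      β * btMfar L (D * recordDelta1 L (1 / 6) β) (powScale (1 / 2) β * btLog β ^ 2 / (2 * (L : ℝ) ^ 2)) (btLog β * powScale (1 / 2) β) (btEps β)
        (13 * (D * recordDelta1 L (1 / 6) β)) := by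
  have hL1 : (1 : ℝ) ≤ L := by exact_mod_cast NeZero.one_le
  have hL0 : (0 : ℝ) < L := by linarith
  have hN : (0 : ℝ) < Fintype.card (Site 3 L) := by exact_mod_cast Fintype.card_pos
  have hD0 : 0 < D := by linarith
  have hc : 0 < (14 * D / (Fintype.card (Site 3 L) : ℝ)) ^ 2 * 36 := by positivity
  filter_upwards [eventually_marginsR (L := L) hD, eventually_scheduleR_facts (L := L) hD,
    (tendsto_powScale_mul_btLog_pow (show (0 : ℝ) < 1 / 3 by norm_num) 4).eventually (eventually_le_nhds hc)] with β hm hf hl4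
  obtain ⟨-, -, -, -, hP0, hJ⟩ := hm
  obtain ⟨hβ1, hℓeq, hℓ1, hδ0, -, -, hx0, -, hβx, -, -, -, -, -, -, -, -, -, -, -, hα0, -⟩ := hf
  have hβ0 : 0 < β := by linarith
  have hm₂0 : 0 ≤ (Fintype.card (Site 3 L) : ℝ) * (powScale (1 / 2) β * btLog β ^ 2 / (2 * (L : ℝ) ^ 2)) / 4 := by positivity
  have hfloor := btMfar_ge_min (L := L) (by positivity : (0 : ℝ) ≤ 6 * (D * recordDelta1 L (1 / 6) β)) hm₂0 hP0 hJ
  have hE3 : (Fintype.card (Edge 3 L) : ℝ) = 3 * (Fintype.card (Site 3 L) : ℝ) := by rw [card_edge_three L, card_site_cube]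
  have hNL : (Fintype.card (Site 3 L) : ℝ) = (L : ℝ) ^ 3 := by rw [card_site_cube]
  -- signal branch
  have hq2 : btLog β ^ 4 / (192 * L) ≤ β * (((Fintype.card (Site 3 L) : ℝ) * (powScale (1 / 2) β * btLog β ^ 2 / (2 * (L : ℝ) ^ 2)) / 4) ^ 2 / Fintype.card (Edge 3 L)) := by
    rw [hE3, hNL]
    have e : β * (((L : ℝ) ^ 3 * (powScale (1 / 2) β * btLog β ^ 2 / (2 * (L : ℝ) ^ 2)) / 4) ^ 2 / (3 * (L : ℝ) ^ 3)) = btLog β ^ 4 / (192 * L) * (β * powScale (1 / 2) β ^ 2) := by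
      field_simp; ring
    rw [e, hβx, mul_one]
  -- rough branch: `ℓ⁴/(192L) ≤ ℓ⁴ ≤ 36βδ²`
  have hq1 : btLog β ^ 4 / (192 * L) ≤ β * (6 * (D * recordDelta1 L (1 / 6) β)) ^ 2 := by
    have hp3 : powScale (1 / 6) β ^ 2 = powScale (1 / 3) β := by
      rw [powScale_eq hβ1, powScale_eq hβ1, ← Real.rpow_mul_natCast hβ0.le]; norm_num
    have hβp : β * powScale (1 / 3) β ^ 3 = 1 := by
      rw [powScale_eq hβ1, ← Real.rpow_mul_natCast hβ0.le, show (-(1 / 3 : ℝ)) * ((3 : ℕ) : ℝ) = -1 by norm_num, Real.rpow_neg_one,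
        mul_inv_cancel₀ hβ0.ne']
    have e1 : β * (6 * (D * recordDelta1 L (1 / 6) β)) ^ 2 = 36 * (14 * D / (Fintype.card (Site 3 L) : ℝ)) ^ 2 * (β * powScale (1 / 3) β) := by
      unfold recordDelta1
      rw [show (6 * (D * (14 * powScale (1 / 6) β / (Fintype.card (Site 3 L) : ℝ)))) ^ 2 = 36 * (14 * D / (Fintype.card (Site 3 L) : ℝ)) ^ 2 * powScale (1 / 6) β ^ 2 by ring, hp3]
      ring
    rw [e1]
    have hℓ4 : 0 ≤ btLog β ^ 4 := by positivity
    have h192 : btLog β ^ 4 / (192 * L) ≤ btLog β ^ 4 := div_le_self hℓ4 (by nlinarith)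
    refine h192.trans ?_
    have hp0 : 0 < powScale (1 / 3) β := powScale_pos _ _
    have hp1 : powScale (1 / 3) β ≤ 1 := powScale_le_one (by norm_num) β
    -- `ℓ⁴ = ℓ⁴p³β ≤ (ℓ⁴ p)·(βp) ≤ 36c²·βp`
    have a : btLog β ^ 4 = (powScale (1 / 3) β * btLog β ^ 4) * powScale (1 / 3) β * (β * powScale (1 / 3) β) := by
      linear_combination (-(btLog β ^ 4)) * hβp
    rw [a]
    have b : (powScale (1 / 3) β * btLog β ^ 4) * powScale (1 / 3) β ≤ (14 * D / (Fintype.card (Site 3 L) : ℝ)) ^ 2 * 36 * 1 :=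
      mul_le_mul hl4 hp1 hp0.le (by positivity)
    have hβp0 : 0 ≤ β * powScale (1 / 3) β := by positivity
    nlinarith [mul_le_mul_of_nonneg_right b hβp0]
  rw [← hℓeq]
  calc btLog β ^ 4 / (192 * L) ≤ min (β * (6 * (D * recordDelta1 L (1 / 6) β)) ^ 2)
        (β * (((Fintype.card (Site 3 L) : ℝ) * (powScale (1 / 2) β * btLog β ^ 2 / (2 * (L : ℝ) ^ 2)) / 4) ^ 2 / Fintype.card (Edge 3 L))) := le_min hq1 hq2
    _ = β * min ((6 * (D * recordDelta1 L (1 / 6) β)) ^ 2) ((((Fintype.card (Site 3 L) : ℝ) * (powScale (1 / 2) β * btLog β ^ 2 / (2 * (L : ℝ) ^ 2)) / 4) ^ 2 / Fintype.card (Edge 3 L))) :=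
        (mul_min_of_nonneg _ _ hβ0.le).symm
    _ ≤ _ := mul_le_mul_of_nonneg_left hfloor hβ0.le

end Summit.QuantumFields.YangMills.Theorems.FemtoTransferGap.TwoLattice.ConstTube

end
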